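import Literature.Probability.Percolation.LoopRepresentationProofs
import HarnessLib

/-!
# First steps of the printed proof of DKKMO's Theorem 1.7: the horizontal symmetry `α ↦ π − α`

Proofs layer of `Literature.Probability.Percolation.LoopRepresentation`, companion of
`LoopRepresentationProofs`. The named fact `dkkmo_theorem_1_7` is Theorem 1.7 of
Duminil-Copin–Kozlowski–Krachun–Manolescu–Oulamara, arXiv:2012.11672v2 (2026), at `q = 1`, `d_CN`
part, as printed: `d_CN(φ_{δL(α)}, φ_{δL(π/2)}) < C δ^c` for all `α ∈ (0, π)`, `δ > 0`. Its
printed proof (§4.2) runs: "Define the set `R = {α ∈ (0, π) : φ_{L(α)}` asymptotically similar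
to `φ_{L(π/2)}}`. [...] In light of Lemma 4.4, `R` is stable by `α ↦ α/2`. Moreover, **by
horizontal symmetry, `R` is stable by `α ↦ π − α`.** Repeatedly applying these transformations
shows that `R` is dense in `(0, π)` [...]" and then Lemma 3.2 (continuity of the drift matrix)
and Proposition 3.13 (the uniform version of Theorem 1.9). This file proves the exact lattice
symmetry behind the second stability, in the printed conventions and quantitatively, and the
elementary reductions of the statement of Theorem 1.7 that follow from it; the deep inputs
(§3, Lemma 4.4, Proposition 3.13) are not touched.

## Contents

* `prodBernoulli_map_image_of_comp_eq` — relabelling a product Bernoulli measure by a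
  permutation `ρ` of the index set with `q ∘ ρ = p` carries `P_p` to `P_q`.
* `isoRectWeight_pi_sub_map_swapSite`, `isoRectPercolation_map_swapSite_pi_sub` — the lattice
  map `swapSite : (m, n) ↦ (-n, -m)` exchanges horizontal and vertical edges of `ℤ²`, hence
  carries `φ_{L(α)}` to `φ_{L(π − α)}` (the weights of `L(π − α)` are those of `L(α)` with the
  roles of horizontal and vertical edges exchanged, §1.4 eq. (5)).
* `isoRectLinear_pi_sub_swap`, `isoRectMedialPoint_pi_sub_map_swapSite` — on the embedded
  lattices this map is the reflection `S_0` in the real axis: `S_0 (L(α)) = L(π − α)`.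
* `isoRectLoopCurve_map_reverse₂`, `mem_isoRectLoopConfig_image_iff₂`,
  `isClose_isoRectLoopConfig_image_iff₂` — two-lattice versions of the reflect-and-reverse
  lemmas of `LoopRotationInvarianceAssembly` / `LoopRepresentationProofs`.
* `cnLawEDist_isoRect_pi_sub` — **horizontal symmetry**:
  `d_CN(φ_{δL(π−α)}, φ_{δ'L(π−β)}) = d_CN(φ_{δL(α)}, φ_{δ'L(β)})` (exact), in particular
  `d_CN(φ_{δL(π−α)}, φ_{δL(π/2)}) = d_CN(φ_{δL(α)}, φ_{δL(π/2)})`.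
* `dkkmo_theorem_1_7_iff_le_pi_div_two` — Theorem 1.7 is equivalent to its restriction to
  `α ∈ (0, π/2]` and `δ ∈ (0, 1)` (horizontal symmetry and `d_CN ≤ 1`).
* `dkkmo_theorem_1_7.pairwise` — from Theorem 1.7, all the measures `φ_{δL(α)}`, `α ∈ (0, π)`,
  are pairwise `2C δ^c`-close (the shape of eq. (96), Proposition 3.13, with constants uniform in
  both angles), by the triangle inequality for the coupling distance.

## References

* H. Duminil-Copin, K. K. Kozlowski, D. Krachun, I. Manolescu, M. Oulamara, *Rotational
  invariance in critical planar lattice models*, arXiv:2012.11672v2 (2026): §1.4 (eq. (5),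
  Theorem 1.7, Theorem 1.9, "Uniformity in angles"), §3.9 (Proposition 3.13, eq. (96)), §4.2
  (proof of Theorem 1.7).
* G. Grimmett, *Percolation*, 2nd ed. (1999), §1.3 (invariance of product measures).
-/

noncomputable section

open Set MeasureTheory Complex
open scoped unitInterval ENNReal Real

namespace Literature.Probability.Percolation

open LatticeModels

/-! ### Relabelling a product Bernoulli measure changes the parameters accordingly -/

section Relabel

variable {ι : Type*}

/-- **Relabelling of `prodBernoulli`.** If the permutation `ρ` of the index set carries the
parameters `p` to the parameters `q` (`q (ρ i) = p i`), then the image map `s ↦ ρ '' s` carries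
the law `P_p` of the random subset to `P_q` (Mathlib's `infinitePi_map_piCongrLeft`; Grimmett
1999, §1.3). [folklore] -/
theorem prodBernoulli_map_image_of_comp_eq (p q : ι → unitInterval) (ρ : ι ≃ ι)
    (hpq : ∀ i, q (ρ i) = p i) :
    (LatticeModels.prodBernoulli p).map (fun s : Set ι => ρ '' s) = LatticeModels.prodBernoulli q := by
  set μ : (ι → unitInterval) → ι → Measure Prop := fun r i =>
    unitInterval.toNNReal (r i) • Measure.dirac True +
      unitInterval.toNNReal (unitInterval.symm (r i)) • Measure.dirac False with hμ
  haveI : ∀ r i, IsProbabilityMeasure (μ r i) := fun r i => by simp only [hμ]; infer_instance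
  have h1 : ∀ r, LatticeModels.prodBernoulli r = (Measure.infinitePi (μ r)).map MeasurableEquiv.setOf := by
    intro r; rw [LatticeModels.prodBernoulli_eq_map]; rfl
  rw [h1, h1, Measure.map_map (measurable_image_equiv ρ) MeasurableEquiv.setOf.measurable,
    image_equiv_eq_comp, Function.comp_assoc, Function.comp_assoc,
    MeasurableEquiv.symm_comp_self, Function.comp_id,
    ← Measure.map_map MeasurableEquiv.setOf.measurable (MeasurableEquiv.measurable _)]
  congr 1
  have hmuperm : (fun i => μ q (ρ i)) = μ p := by
    funext i; simp only [hμ, hpq]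
  conv_lhs => rw [← hmuperm]
  exact Measure.infinitePi_map_piCongrLeft (X := fun _ : ι => Prop) (μ q) ρ

end Relabel

/-! ### `swapSite` carries `φ_{L(α)}` to `φ_{L(π − α)}` -/

/-- For an edge `{x, y}` of `ℤ²`, the first coordinates agree iff the second ones differ
(exactly one coordinate changes along an edge). [folklore] -/
theorem apply_zero_eq_iff_of_adj {x y : Site 2} (h : (zdGraph 2).Adj x y) : x 0 = y 0 ↔ ¬ x 1 = y 1 := by
  obtain ⟨i, hi⟩ := (zdGraph_adj_iff x y).1 h
  fin_cases i <;> rcases hi with rfl | rfl <;> simp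

/-- `swapSite : (m, n) ↦ (-n, -m)` exchanges horizontal and vertical edges of `ℤ²`. [folklore] -/
theorem isHorizontal_map_swapSite_iff {e : Sym2 (Site 2)} (he : e ∈ (zdGraph 2).edgeSet) :
    IsHorizontal (e.map swapSite) ↔ ¬ IsHorizontal e := by
  induction e using Sym2.ind with
  | h x y =>
    rw [SimpleGraph.mem_edgeSet] at he
    rw [Sym2.map_mk, isHorizontal_mk, isHorizontal_mk, swapSite_one, swapSite_one, neg_inj]
    exact apply_zero_eq_iff_of_adj he

open scoped Classical in
/-- **The weights of `L(π − α)` are those of `L(α)` with horizontal and vertical edges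
exchanged** (DKKMO §1.4, eq. (5) at `q = 1`: `p_hor(π − α) = p_vert(α)`): `isoRectWeight (π − α)
(swapSite e) = isoRectWeight α e`. [cite: arXiv201211672v2, §1.4] -/
theorem isoRectWeight_pi_sub_map_swapSite (α : ℝ) (e : Sym2 (Site 2)) :
    isoRectWeight (π - α) (e.map swapSite) = isoRectWeight α e := by
  unfold isoRectWeight
  by_cases he : e ∈ (zdGraph 2).edgeSet
  · rw [if_pos (isLatticeReflection_swapSite.map_mem_edgeSet he), if_pos he,
      isHorizontal_map_swapSite_iff he, sub_sub_cancel]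
    by_cases hh : IsHorizontal e
    · rw [if_neg (not_not_intro hh), if_pos hh]
    · rw [if_pos hh, if_neg hh]
  · rw [if_neg (fun h => he (isLatticeReflection_swapSite.map_mem_edgeSet_iff.1 h)), if_neg he]

/-- **`swapSite` carries `φ_{L(α)}` to `φ_{L(π − α)}`**: the image of `isoRectPercolation α`
under `ω ↦ swapSite(ω)` is `isoRectPercolation (π − α)`. At `α = π/2` this is the symmetry
`isoRectPercolation_map_swapSite` of `φ_{L(π/2)}` (DKKMO §4.1). (DKKMO, arXiv:2012.11672v2, §4.2:
"by horizontal symmetry, `R` is stable by `α ↦ π − α`".) [cite: arXiv201211672v2, §4.2] -/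
theorem isoRectPercolation_map_swapSite_pi_sub (α : ℝ) :
    (isoRectPercolation α).map (fun ω => swapPerm '' ω) = isoRectPercolation (π - α) :=
  prodBernoulli_map_image_of_comp_eq _ _ swapPerm fun e => by
    rw [coe_swapPerm, isoRectWeight_pi_sub_map_swapSite]

/-! ### On the embedded lattices `swapSite` is the reflection `S_0`: `S_0 (L(α)) = L(π − α)` -/

/-- **`S_0` maps `L(α)` onto `L(π − α)`**: the embedding of `L(π − α)` intertwines `z ↦ -i z̄`
(the map `swapSite` on `ℤ² = ℤ[i]`) with the complex conjugation `S_0`: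
`isoRectLinear (π − α) (-i w̄) = conj (isoRectLinear α w)`. (DKKMO, arXiv:2012.11672v2, §1.4:
`L(α)` has horizontal edges of length `2 cos(α/2)`, vertical ones of length `2 sin(α/2)`, and is
rotated by `α/2`; so `L(π − α)` is the mirror image of `L(α)` in the real axis, with the two
families of edges exchanged.) [cite: arXiv201211672v2, §1.4] -/
theorem isoRectLinear_pi_sub_swap (α : ℝ) (w : ℂ) :
    isoRectLinear (π - α) (-Complex.I * (starRingEnd ℂ) w) =
      RandomPlanarGeometry.lineReflection 0 (isoRectLinear α w) := by
  rw [RandomPlanarGeometry.lineReflection_apply, mul_zero, Circle.exp_zero, Circle.coe_one, one_mul,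
    isoRectLinear_apply, isoRectLinear_apply]
  have hc : Real.cos ((π - α) / 2) = Real.sin (α / 2) := by
    rw [show (π - α) / 2 = π / 2 - α / 2 by ring, Real.cos_pi_div_two_sub]
  have hs : Real.sin ((π - α) / 2) = Real.cos (α / 2) := by
    rw [show (π - α) / 2 = π / 2 - α / 2 by ring, Real.sin_pi_div_two_sub]
  have he : Complex.exp ((((π - α) / 2 : ℝ) : ℂ) * Complex.I) =
      (Real.sin (α / 2) : ℂ) + (Real.cos (α / 2) : ℂ) * Complex.I := by
    rw [Complex.exp_mul_I, ← Complex.ofReal_cos, ← Complex.ofReal_sin, hc, hs]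
  have he' : Complex.exp (((α / 2 : ℝ) : ℂ) * Complex.I) =
      (Real.cos (α / 2) : ℂ) + (Real.sin (α / 2) : ℂ) * Complex.I := by
    rw [Complex.exp_mul_I, ← Complex.ofReal_cos, ← Complex.ofReal_sin]
  have hre : (-Complex.I * (starRingEnd ℂ) w).re = -w.im := by simp
  have him : (-Complex.I * (starRingEnd ℂ) w).im = -w.re := by simp
  rw [he, he', hc, hs, hre, him]
  simp only [map_mul, map_add, Complex.conj_ofReal, Complex.conj_I]
  push_cast
  linear_combination (-2 * (Complex.sin ((α : ℂ) / 2) ^ 2 * (w.im : ℂ) +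
    Complex.cos ((α : ℂ) / 2) ^ 2 * (w.re : ℂ))) * Complex.I_mul_I

/-- `S_0` realises `swapSite` as a map from the midpoints of `δL(α)` to those of `δL(π − α)`.
[cite: arXiv201211672v2, §1.4] -/
theorem isoRectMedialPoint_pi_sub_map_swapSite (δ α : ℝ) (e : MedialVertex) :
    isoRectMedialPoint δ (π - α) (e.map swapSite) =
      RandomPlanarGeometry.lineReflection 0 (isoRectMedialPoint δ α e) := by
  rw [isoRectMedialPoint, isoRectMedialPoint, medialPoint_map_swapSite, isoRectLinear_pi_sub_swap]

/-! ### Reflect-and-reverse between two lattices -/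

/-- Two-lattice version of `isoRectLoopCurve_map_reverse`: if the lattice map `τ` is realised by
the linear isometry `S` as a map from the midpoints of `δL(α)` to those of `δL(β)`, the loop drawn
on `δL(β)` by a `τ`-image list read backwards is the `S`-image, reversed, of the loop drawn on
`δL(α)` by a rotation of the list. [folklore] -/
theorem isoRectLoopCurve_map_reverse₂ {τ : Site 2 → Site 2} {S : ℂ ≃ₗᵢ[ℝ] ℂ} {δ α β : ℝ}
    (hS : ∀ e, isoRectMedialPoint δ β (e.map τ) = S (isoRectMedialPoint δ α e))
    {μ : List MedialVertex} (hμ : μ ≠ []) :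
    isoRectLoopCurve δ β ((μ.map (Sym2.map τ)).reverse) =
      ((isoRectLoopCurve δ α (μ.rotate (μ.length - 1))).map (RandomPlanarGeometry.toCM S)).reverse := by
  obtain ⟨init, last, rfl⟩ : ∃ init last, μ = init ++ [last] :=
    ⟨μ.dropLast, μ.getLast hμ, (List.dropLast_append_getLast hμ).symm⟩
  rw [show (init ++ [last]).length - 1 = init.length by simp, List.rotate_append_length_eq]
  have hl : (((init ++ [last]).map (Sym2.map τ)).reverse ++
      (((init ++ [last]).map (Sym2.map τ)).reverse).take 1).map (isoRectMedialPoint δ β) =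
      ((([last] ++ init ++ ([last] ++ init).take 1).map (isoRectMedialPoint δ α)).reverse).map S := by
    simp [List.map_reverse, hS]
  simp only [isoRectLoopCurve]
  rw [hl, RandomPlanarGeometry.CurveClass.reverse_map, RandomPlanarGeometry.CurveClass.reverse_mk,
    RandomPlanarGeometry.CurveClass.map_mk]
  set Q := ([last] ++ init ++ ([last] ++ init).take 1).map (isoRectMedialPoint δ α) with hQ
  have hrev : RandomPlanarGeometry.CurveClass.mk (E := ℂ) ⟨polyline Q.reverse⟩ =
      RandomPlanarGeometry.CurveClass.mk (RandomPlanarGeometry.Curve.reverse ⟨polyline Q⟩) :=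
    RandomPlanarGeometry.CurveClass.mk_eq_mk.2 (reparamDist_polyline_reverse Q)
  have hmap : (⟨polyline (Q.reverse.map S)⟩ : RandomPlanarGeometry.Curve ℂ) =
      (⟨polyline Q.reverse⟩ : RandomPlanarGeometry.Curve ℂ).map (RandomPlanarGeometry.toCM S) := by
    ext t
    change polyline (Q.reverse.map S) t = S (polyline Q.reverse t)
    rw [apply_polyline S (map_zero S)
      (fun x y c => by simp only [AffineMap.lineMap_apply_module, map_add, map_smul])]
  rw [hmap, ← RandomPlanarGeometry.CurveClass.map_mk, hrev, RandomPlanarGeometry.CurveClass.map_mk]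

/-- Two-lattice version of `mem_isoRectLoopConfig_image_iff`: for a lattice reflection `τ`
realised by the linear isometry `S` from the midpoints of `δL(α)` to those of `δL(β)` and
preserving types-after-reversal, `u` is a loop of type `i` of `τ(ω)` drawn on `δL(β)` iff `u` read
backwards is the `S`-image of a loop of type `i` of `ω` drawn on `δL(α)`. [folklore] -/
theorem mem_isoRectLoopConfig_image_iff₂ {τ τF : Site 2 → Site 2} (hτ : IsLatticeReflection τ τF)
    {S : ℂ ≃ₗᵢ[ℝ] ℂ} {δ α β : ℝ}
    (hS : ∀ e, isoRectMedialPoint δ β (e.map τ) = S (isoRectMedialPoint δ α e))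
    (ht : ∀ γ : List MedialVertex, loopType ((γ.map (Sym2.map τ)).reverse) = loopType γ)
    (ω : BondConfig (Site 2)) (i : Fin 2) (u : RandomPlanarGeometry.UnbasedLoop ℂ) :
    u ∈ (isoRectLoopConfig δ β (Sym2.map τ '' ω)).F i ↔
      u.reverse ∈ ((isoRectLoopConfig δ α ω).map (RandomPlanarGeometry.toCM S) S.isometry).F i := by
  rw [mem_isoRectLoopConfig_iff, RandomPlanarGeometry.LoopConfig.mem_map_iff]
  constructor
  · rintro ⟨γ', hγ', hti, rfl⟩
    set μ := (γ'.map (Sym2.map τ)).reverse with hμdef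
    have hμγ : (μ.map (Sym2.map τ)).reverse = γ' := by
      simp [hμdef, List.map_reverse, List.map_map, Function.comp_def, hτ.map_map]
    have hμ : IsInterfaceLoop ω μ := by simpa [hτ.image_image] using hτ.isInterfaceLoop hγ'
    have key := isoRectLoopCurve_map_reverse₂ hS hμ.ne_nil
    rw [hμγ] at key
    have hrot : IsInterfaceLoop ω (μ.rotate (μ.length - 1)) := IsInterfaceLoop.rotate_holds hμ _
    refine ⟨RandomPlanarGeometry.UnbasedLoop.mk (RandomPlanarGeometry.BasedLoop.mk
      (isoRectLoopCurve δ α (μ.rotate (μ.length - 1))) (isLoop_isoRectLoopCurve δ α hrot.ne_nil)), ?_, ?_⟩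
    · refine (mem_isoRectLoopConfig_iff).2 ⟨_, hrot, ?_, rfl⟩
      rw [loopType_rotate, ← ht μ, hμγ, hti]
    · rw [RandomPlanarGeometry.UnbasedLoop.map_mk, RandomPlanarGeometry.UnbasedLoop.reverse_mk]
      congr 1
      apply RandomPlanarGeometry.BasedLoop.mk_eq_mk.2
      change (isoRectLoopCurve δ α (μ.rotate (μ.length - 1))).map (RandomPlanarGeometry.toCM S) =
        (isoRectLoopCurve δ β γ').reverse
      rw [key, RandomPlanarGeometry.CurveClass.reverse_reverse]
  · rintro ⟨_, ⟨γ, hγ, hti, rfl⟩, hu⟩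
    have hμ : IsInterfaceLoop ω (γ.rotate 1) := IsInterfaceLoop.rotate_holds hγ 1
    have key := isoRectLoopCurve_map_reverse₂ hS hμ.ne_nil
    have hrot : (γ.rotate 1).rotate ((γ.rotate 1).length - 1) = γ := by
      rw [List.length_rotate, List.rotate_rotate,
        show 1 + (γ.length - 1) = γ.length by have := hγ.length_pos; omega, List.rotate_length]
    rw [hrot] at key
    have hγ'' : IsInterfaceLoop (Sym2.map τ '' ω) (((γ.rotate 1).map (Sym2.map τ)).reverse) :=
      hτ.isInterfaceLoop hμ
    refine ⟨_, hγ'', by rw [ht, loopType_rotate, hti], ?_⟩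
    rw [← RandomPlanarGeometry.UnbasedLoop.reverse_reverse u, hu.symm, RandomPlanarGeometry.UnbasedLoop.map_mk,
      RandomPlanarGeometry.UnbasedLoop.reverse_mk]
    congr 1
    apply RandomPlanarGeometry.BasedLoop.mk_eq_mk.2
    exact key.symm

/-- Two-lattice version of `isClose_isoRectLoopConfig_image_iff`: for `d_CN ≤ ε` the typed loop
representation of `τ(ω)` on `δL(β)` may be replaced by the `S`-image of that of `ω` on `δL(α)`
(reversal of the members is invisible to the unoriented distance `d`). [folklore] -/
theorem isClose_isoRectLoopConfig_image_iff₂ {τ τF : Site 2 → Site 2} (hτ : IsLatticeReflection τ τF)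
    {S : ℂ ≃ₗᵢ[ℝ] ℂ} {δ α β : ℝ}
    (hS : ∀ e, isoRectMedialPoint δ β (e.map τ) = S (isoRectMedialPoint δ α e))
    (ht : ∀ γ : List MedialVertex, loopType ((γ.map (Sym2.map τ)).reverse) = loopType γ)
    (ω : BondConfig (Site 2)) (ε : ℝ) (c : RandomPlanarGeometry.LoopConfig ℂ) :
    RandomPlanarGeometry.LoopConfig.IsClose ε (isoRectLoopConfig δ β (Sym2.map τ '' ω)) c ↔
      RandomPlanarGeometry.LoopConfig.IsClose ε
        ((isoRectLoopConfig δ α ω).map (RandomPlanarGeometry.toCM S) S.isometry) c :=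
  RandomPlanarGeometry.LoopConfig.isClose_congr_of_reverse_mem
    (mem_isoRectLoopConfig_image_iff₂ hτ hS ht ω)

/-! ### Horizontal symmetry: `d_CN(φ_{δL(π−α)}, φ_{δ'L(π−β)}) = d_CN(φ_{δL(α)}, φ_{δ'L(β)})` -/

/-- One inequality of the horizontal symmetry (the other is the same statement at `π − α`,
`π − β`). Transport of couplings along the measure-class map `swapSite` on both coordinates
(`cnLawEDist_map_le`, `isoRectPercolation_map_swapSite_pi_sub`) and invariance of `d_CN ≤ ε`
under the common isometry `S_0` fixing the origin (`isClose_map_iff`). [cite: arXiv201211672v2, §4.2] -/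
theorem cnLawEDist_isoRect_pi_sub_le (α β δ δ' : ℝ) :
    RandomPlanarGeometry.LoopConfig.cnLawEDist (isoRectPercolation (π - α)) (isoRectLoopConfig δ (π - α))
        (isoRectPercolation (π - β)) (isoRectLoopConfig δ' (π - β)) ≤
      RandomPlanarGeometry.LoopConfig.cnLawEDist (isoRectPercolation α) (isoRectLoopConfig δ α)
        (isoRectPercolation β) (isoRectLoopConfig δ' β) := by
  set g : BondConfig (Site 2) → BondConfig (Site 2) := fun ω ↦ swapPerm '' ω with hg
  have hgm : Measurable g := measurable_image_equiv swapPerm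
  set S₀ : ℂ ≃ₗᵢ[ℝ] ℂ := RandomPlanarGeometry.lineReflection 0 with hS₀def
  have hS₀ : Isometry (RandomPlanarGeometry.toCM S₀) := S₀.isometry
  have hS₀0 : RandomPlanarGeometry.toCM S₀ 0 = 0 := map_zero S₀
  have hmS := fun i (k : {γ : List MedialVertex // γ ≠ []}) ↦ measurableSet_setOf_isInterfaceLoop_and k.1 i
  have hm : ∀ ε, MeasurableSet {p : BondConfig (Site 2) × BondConfig (Site 2) |
      RandomPlanarGeometry.LoopConfig.IsClose ε (isoRectLoopConfig δ (π - α) p.1)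
        (isoRectLoopConfig δ' (π - β) p.2)} := fun ε ↦
    RandomPlanarGeometry.LoopConfig.measurableSet_isClose_of_gen hmS (gen_isoRectLoopConfig δ (π - α)) hmS
      (gen_isoRectLoopConfig δ' (π - β)) ε
  have key := RandomPlanarGeometry.LoopConfig.cnLawEDist_map_le hgm hgm (isoRectPercolation α)
    (isoRectPercolation β) (isoRectLoopConfig δ (π - α)) (isoRectLoopConfig δ' (π - β)) hm
  rw [hg, isoRectPercolation_map_swapSite_pi_sub α, isoRectPercolation_map_swapSite_pi_sub β] at key
  refine key.trans (le_of_eq (RandomPlanarGeometry.LoopConfig.cnLawEDist_congr fun ε ω ω' ↦ ?_))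
  simp only [Function.comp_apply, coe_swapPerm]
  rw [isClose_isoRectLoopConfig_image_iff₂ isLatticeReflection_swapSite (S := S₀)
      (isoRectMedialPoint_pi_sub_map_swapSite δ α) loopType_map_swapSite_reverse ω,
    RandomPlanarGeometry.LoopConfig.isClose_comm,
    isClose_isoRectLoopConfig_image_iff₂ isLatticeReflection_swapSite (S := S₀)
      (isoRectMedialPoint_pi_sub_map_swapSite δ' β) loopType_map_swapSite_reverse ω',
    RandomPlanarGeometry.LoopConfig.isClose_map_iff hS₀ hS₀0, RandomPlanarGeometry.LoopConfig.isClose_comm]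

/-- **Horizontal symmetry** (DKKMO, arXiv:2012.11672v2, §4.2, proof of Theorem 1.7: "by
horizontal symmetry, `R` is stable by `α ↦ π − α`"), exact and quantitative, in the printed
conventions: `d_CN(φ_{δL(π−α)}, φ_{δ'L(π−β)}) = d_CN(φ_{δL(α)}, φ_{δ'L(β)})` for all angles and
meshes. Mechanism: the reflection `S_0` maps `δL(α)` onto `δL(π − α)` exchanging the two families
of edges together with their weights (`isoRectPercolation_map_swapSite_pi_sub`,
`isoRectMedialPoint_pi_sub_map_swapSite`), maps cluster interfaces to cluster interfaces read
backwards with the same types (`IsLatticeReflection.isInterfaceLoop`,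
`loopType_map_swapSite_reverse`), and is an isometry fixing the origin, under which the relation
`d_CN ≤ ε` of §1.2 is invariant (`isClose_map_iff`). [cite: arXiv201211672v2, §4.2] -/
theorem cnLawEDist_isoRect_pi_sub (α β δ δ' : ℝ) :
    RandomPlanarGeometry.LoopConfig.cnLawEDist (isoRectPercolation (π - α)) (isoRectLoopConfig δ (π - α))
        (isoRectPercolation (π - β)) (isoRectLoopConfig δ' (π - β)) =
      RandomPlanarGeometry.LoopConfig.cnLawEDist (isoRectPercolation α) (isoRectLoopConfig δ α)
        (isoRectPercolation β) (isoRectLoopConfig δ' β) := by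
  refine le_antisymm (cnLawEDist_isoRect_pi_sub_le α β δ δ') ?_
  have h := cnLawEDist_isoRect_pi_sub_le (π - α) (π - β) δ δ'
  rwa [sub_sub_cancel, sub_sub_cancel] at h

/-- Horizontal symmetry about `φ_{L(π/2)}`: `d_CN(φ_{δL(π−α)}, φ_{δL(π/2)}) =
d_CN(φ_{δL(α)}, φ_{δL(π/2)})` — the set `R` of angles asymptotically similar to `π/2`, and every
quantitative version of it, is stable under `α ↦ π − α`. (DKKMO, arXiv:2012.11672v2, §4.2.) [cite: arXiv201211672v2, §4.2] -/
theorem cnLawEDist_isoRect_pi_sub_pi_div_two (α δ : ℝ) :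
    RandomPlanarGeometry.LoopConfig.cnLawEDist (isoRectPercolation (π - α)) (isoRectLoopConfig δ (π - α))
        (isoRectPercolation (π / 2)) (isoRectLoopConfig δ (π / 2)) =
      RandomPlanarGeometry.LoopConfig.cnLawEDist (isoRectPercolation α) (isoRectLoopConfig δ α)
        (isoRectPercolation (π / 2)) (isoRectLoopConfig δ (π / 2)) := by
  have h := cnLawEDist_isoRect_pi_sub α (π / 2) δ δ
  rwa [show π - π / 2 = π / 2 by ring] at h

/-! ### Reductions of the statement of Theorem 1.7 -/

/-- **Theorem 1.7 reduces to acute angles and small meshes**: `dkkmo_theorem_1_7` holds iff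
there are `c, C > 0` with `d_CN(φ_{δL(α)}, φ_{δL(π/2)}) < C δ^c` for all `α ∈ (0, π/2]` and
`δ ∈ (0, 1)`. The obtuse angles follow by horizontal symmetry
(`cnLawEDist_isoRect_pi_sub_pi_div_two`), the meshes `δ ≥ 1` from `d_CN ≤ 1`
(`cnLawEDist_le_one`) after enlarging `C` to `max C 2`. (DKKMO, arXiv:2012.11672v2, §4.2.) [cite: arXiv201211672v2, §4.2] -/
theorem dkkmo_theorem_1_7_iff_le_pi_div_two :
    dkkmo_theorem_1_7 ↔ ∃ c C : ℝ, 0 < c ∧ 0 < C ∧ ∀ α ∈ Set.Ioc (0 : ℝ) (π / 2), ∀ δ ∈ Set.Ioo (0 : ℝ) 1,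
      RandomPlanarGeometry.LoopConfig.cnLawEDist (isoRectPercolation α) (isoRectLoopConfig δ α)
        (isoRectPercolation (π / 2)) (isoRectLoopConfig δ (π / 2)) < ENNReal.ofReal (C * δ ^ c) := by
  constructor
  · rintro ⟨c, C, hc, hC, h⟩
    refine ⟨c, C, hc, hC, fun α hα δ hδ ↦ h α ⟨hα.1, hα.2.trans_lt (by linarith [Real.pi_pos])⟩ δ hδ.1⟩
  · rintro ⟨c, C, hc, hC, h⟩
    refine ⟨c, max C 2, hc, lt_max_of_lt_left hC, fun α hα δ hδ ↦ ?_⟩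
    rcases lt_or_ge δ 1 with hδ1 | hδ1
    · -- small mesh: acute angles from the hypothesis, obtuse ones by horizontal symmetry
      have hmono : ENNReal.ofReal (C * δ ^ c) ≤ ENNReal.ofReal (max C 2 * δ ^ c) :=
        ENNReal.ofReal_le_ofReal (mul_le_mul_of_nonneg_right (le_max_left _ _)
          (Real.rpow_nonneg hδ.le _))
      rcases le_or_gt α (π / 2) with hαle | hαgt
      · exact (h α ⟨hα.1, hαle⟩ δ ⟨hδ, hδ1⟩).trans_le hmono
      · have hβ : π - α ∈ Set.Ioc (0 : ℝ) (π / 2) := ⟨by linarith [hα.2], by linarith⟩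
        rw [← sub_sub_cancel π α, cnLawEDist_isoRect_pi_sub_pi_div_two]
        exact (h (π - α) hβ δ ⟨hδ, hδ1⟩).trans_le hmono
    · -- large mesh: `d_CN ≤ 1 < 2 ≤ max C 2 * δ ^ c`
      refine (RandomPlanarGeometry.LoopConfig.cnLawEDist_le_one _ _ _ _).trans_lt ?_
      rw [← ENNReal.ofReal_one]
      refine (ENNReal.ofReal_lt_ofReal_iff (by positivity)).2 ?_
      have h1 : (1 : ℝ) ≤ δ ^ c := Real.one_le_rpow hδ1 hc.le
      nlinarith [le_max_right C 2]

/-- **Pairwise form of Theorem 1.7** (the shape of Proposition 3.13, eq. (96), and of Theorem 1.9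
with `M_{β,α} = id`, here with constants uniform in both angles): from `dkkmo_theorem_1_7`, there
are `c, C > 0` with `d_CN(φ_{δL(α)}, φ_{δL(β)}) ≤ C δ^c` for all `α, β ∈ (0, π)` and `δ > 0` —
the triangle inequality for the coupling distance through `φ_{δL(π/2)}` (`cnLawEDist_triangle`,
coupling gluing), constant `2C`. (DKKMO, arXiv:2012.11672v2, §1.4: "Theorem 1.7 is equivalent to
Theorem 1.9 with the additional input that `M_{π/2,α} = id`"; §3.9, Proposition 3.13.) [cite: arXiv201211672v2, Prop 3.13] -/
theorem dkkmo_theorem_1_7.pairwise (h17 : dkkmo_theorem_1_7) :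
    ∃ c C : ℝ, 0 < c ∧ 0 < C ∧ ∀ α ∈ Set.Ioo (0 : ℝ) π, ∀ β ∈ Set.Ioo (0 : ℝ) π, ∀ δ : ℝ, 0 < δ →
      RandomPlanarGeometry.LoopConfig.cnLawEDist (isoRectPercolation α) (isoRectLoopConfig δ α)
        (isoRectPercolation β) (isoRectLoopConfig δ β) ≤ ENNReal.ofReal (C * δ ^ c) := by
  haveI := standardBorelSpace_bondConfig
  obtain ⟨c, C, hc, hC, h⟩ := h17
  refine ⟨c, 2 * C, hc, by positivity, fun α hα β hβ δ hδ ↦ ?_⟩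
  have hmS := fun i (k : {γ : List MedialVertex // γ ≠ []}) ↦ measurableSet_setOf_isInterfaceLoop_and k.1 i
  have hm : ∀ ε, MeasurableSet {p : BondConfig (Site 2) × BondConfig (Site 2) |
      RandomPlanarGeometry.LoopConfig.IsClose ε (isoRectLoopConfig δ α p.1) (isoRectLoopConfig δ β p.2)} :=
    fun ε ↦ RandomPlanarGeometry.LoopConfig.measurableSet_isClose_of_gen hmS (gen_isoRectLoopConfig δ α) hmS
      (gen_isoRectLoopConfig δ β) ε
  refine (RandomPlanarGeometry.LoopConfig.cnLawEDist_triangle (isoRectPercolation α)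
    (isoRectPercolation (π / 2)) (isoRectPercolation β) (isoRectLoopConfig δ α)
    (isoRectLoopConfig δ (π / 2)) (isoRectLoopConfig δ β) hm).trans ?_
  have hCδ : 0 ≤ C * δ ^ c := mul_nonneg hC.le (Real.rpow_nonneg hδ.le _)
  rw [show 2 * C * δ ^ c = C * δ ^ c + C * δ ^ c by ring, ENNReal.ofReal_add hCδ hCδ]
  refine add_le_add (h α hα δ hδ).le ?_
  rw [RandomPlanarGeometry.LoopConfig.cnLawEDist_comm]
  exact (h β hβ δ hδ).le


/-! ### Rotation and reflection defects of `φ_{δL(α)}` in the printed conventions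

For the steps "Theorem 1.2 implies that `φ_{L(π/2)}` is asymptotically rotationally invariant. As
a consequence of the definition of `R`, so is `φ_{L(α)}` for any `α ∈ R`" and "`φ_{δL(β)}` is
invariant under `S_{β/2}` and is assumed asymptotically rotationally invariant, which implies that
it is asymptotically invariant under all reflections" of §4.2 we record, for the rotation defect
`ρ_α^δ(θ) := d_CN((φ_{L(α)}, X_α^δ), (φ_{L(α)}, R_θ ∘ X_α^δ))` (`X_α^δ = isoRectLoopConfig δ α`,
`R_θ` the rotation by `θ`): the cocycle bookkeeping, sub-additivity in `θ`, the transfer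
`ρ_α ≤ 2 d_CN(φ_{δL(α)}, φ_{δL(π/2)}) + ρ_{π/2}`, and the domination of every reflection defect by
a rotation defect. -/

/-- Composition of rotations, as continuous maps (bookkeeping). [folklore] -/
theorem toCM_rotation_comp (θ θ' : ℝ) :
    (RandomPlanarGeometry.toCM (rotation (Circle.exp θ))).comp
        (RandomPlanarGeometry.toCM (rotation (Circle.exp θ'))) =
      RandomPlanarGeometry.toCM (rotation (Circle.exp (θ + θ'))) := by
  ext1 z
  change rotation (Circle.exp θ) (rotation (Circle.exp θ') z) = rotation (Circle.exp (θ + θ')) z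
  rw [rotation_apply, rotation_apply, rotation_apply, Circle.exp_add, Circle.coe_mul]
  ring

/-- The rotation by `0` is the identity, as continuous maps (bookkeeping). [folklore] -/
theorem toCM_rotation_zero :
    RandomPlanarGeometry.toCM (rotation (Circle.exp 0)) = ContinuousMap.id ℂ := by
  ext1 z
  change rotation (Circle.exp 0) z = z
  rw [Circle.exp_zero, rotation_apply, Circle.coe_one, one_mul]

/-- `S_φ = R_{2φ − α} ∘ S_{α/2}`: every line reflection is the symmetry `S_{α/2}` of `L(α)`
followed by a rotation (DKKMO, Remark 1.8: two reflections compose to a rotation). [cite: arXiv201211672v2, Remark 1.8] -/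
theorem toCM_rotation_comp_lineReflection (α φ : ℝ) :
    (RandomPlanarGeometry.toCM (rotation (Circle.exp (2 * φ - α)))).comp
        (RandomPlanarGeometry.toCM (RandomPlanarGeometry.lineReflection (α / 2))) =
      RandomPlanarGeometry.toCM (RandomPlanarGeometry.lineReflection φ) := by
  ext1 z
  change rotation (Circle.exp (2 * φ - α)) (RandomPlanarGeometry.lineReflection (α / 2) z) =
    RandomPlanarGeometry.lineReflection φ z
  rw [RandomPlanarGeometry.lineReflection_apply, RandomPlanarGeometry.lineReflection_apply,
    rotation_apply, ← mul_assoc, ← Circle.coe_mul, ← Circle.exp_add,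
    show 2 * φ - α + 2 * (α / 2) = 2 * φ by ring]

/-- Measurability of `{d_CN ≤ ε}` between a loop representation on `δL(α)` and the image under a
linear isometry of one on `δ'L(β)` (countable generation). [folklore] -/
theorem measurableSet_isClose_isoRectLoopConfig_map (δ α δ' β : ℝ) (S : ℂ ≃ₗᵢ[ℝ] ℂ) (ε : ℝ) :
    MeasurableSet {p : BondConfig (Site 2) × BondConfig (Site 2) |
      RandomPlanarGeometry.LoopConfig.IsClose ε (isoRectLoopConfig δ α p.1)
        ((isoRectLoopConfig δ' β p.2).map (RandomPlanarGeometry.toCM S) S.isometry)} :=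
  RandomPlanarGeometry.LoopConfig.measurableSet_isClose_of_gen
    (fun i (k : {γ : List MedialVertex // γ ≠ []}) ↦ measurableSet_setOf_isInterfaceLoop_and k.1 i)
    (gen_isoRectLoopConfig δ α)
    (fun i (k : {γ : List MedialVertex // γ ≠ []}) ↦ measurableSet_setOf_isInterfaceLoop_and k.1 i)
    (RandomPlanarGeometry.LoopConfig.gen_map (gen_isoRectLoopConfig δ' β) (RandomPlanarGeometry.toCM S)
      S.isometry) ε

/-- Measurability of `{d_CN ≤ ε}` between two loop representations on isoradial rectangular
lattices (countable generation). [folklore] -/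
theorem measurableSet_isClose_isoRectLoopConfig (δ α δ' β : ℝ) (ε : ℝ) :
    MeasurableSet {p : BondConfig (Site 2) × BondConfig (Site 2) |
      RandomPlanarGeometry.LoopConfig.IsClose ε (isoRectLoopConfig δ α p.1) (isoRectLoopConfig δ' β p.2)} :=
  RandomPlanarGeometry.LoopConfig.measurableSet_isClose_of_gen
    (fun i (k : {γ : List MedialVertex // γ ≠ []}) ↦ measurableSet_setOf_isInterfaceLoop_and k.1 i)
    (gen_isoRectLoopConfig δ α)
    (fun i (k : {γ : List MedialVertex // γ ≠ []}) ↦ measurableSet_setOf_isInterfaceLoop_and k.1 i)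
    (gen_isoRectLoopConfig δ' β) ε

/-- `ρ_α^δ(θ + 2πn) = ρ_α^δ(θ)`: the rotation defect is `2π`-periodic. [folklore] -/
theorem cnLawEDist_isoRect_rotation_periodic (α δ θ : ℝ) (n : ℤ) :
    RandomPlanarGeometry.LoopConfig.cnLawEDist (isoRectPercolation α) (isoRectLoopConfig δ α)
        (isoRectPercolation α) (fun ω ↦ (isoRectLoopConfig δ α ω).map
          (RandomPlanarGeometry.toCM (rotation (Circle.exp (θ + n * (2 * π)))))
          (rotation (Circle.exp (θ + n * (2 * π)))).isometry) =
      RandomPlanarGeometry.LoopConfig.cnLawEDist (isoRectPercolation α) (isoRectLoopConfig δ α)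
        (isoRectPercolation α) (fun ω ↦ (isoRectLoopConfig δ α ω).map
          (RandomPlanarGeometry.toCM (rotation (Circle.exp θ))) (rotation (Circle.exp θ)).isometry) := by
  have h : Circle.exp (θ + n * (2 * π)) = Circle.exp θ := Circle.exp_eq_exp.2 ⟨n, rfl⟩
  simp only [h]

/-- `ρ_α^δ(0) = 0`: the diagonal coupling. [folklore] -/
theorem cnLawEDist_isoRect_rotation_zero (α δ : ℝ) :
    RandomPlanarGeometry.LoopConfig.cnLawEDist (isoRectPercolation α) (isoRectLoopConfig δ α)
        (isoRectPercolation α) (fun ω ↦ (isoRectLoopConfig δ α ω).map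
          (RandomPlanarGeometry.toCM (rotation (Circle.exp 0))) (rotation (Circle.exp 0)).isometry) = 0 := by
  have hfun : (fun ω ↦ (isoRectLoopConfig δ α ω).map
      (RandomPlanarGeometry.toCM (rotation (Circle.exp 0))) (rotation (Circle.exp 0)).isometry) =
      isoRectLoopConfig δ α := by
    funext ω
    rw [RandomPlanarGeometry.LoopConfig.map_congr toCM_rotation_zero _ isometry_id,
      RandomPlanarGeometry.LoopConfig.map_id]
  rw [hfun]
  exact RandomPlanarGeometry.LoopConfig.cnLawEDist_self _ _ (measurableSet_isClose_isoRectLoopConfig δ α δ α)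

/-- **Sub-additivity of the rotation defect**: `ρ_α^δ(θ + θ') ≤ ρ_α^δ(θ) + ρ_α^δ(θ')` — the
triangle inequality for the coupling distance through `R_θ ∘ X_α^δ` (`cnLawEDist_triangle`) and
the invariance of `d_CN ≤ ε` under the rotation `R_θ` (`isClose_map_iff`). [folklore] -/
theorem cnLawEDist_isoRect_rotation_subadditive (α δ θ θ' : ℝ) :
    RandomPlanarGeometry.LoopConfig.cnLawEDist (isoRectPercolation α) (isoRectLoopConfig δ α)
        (isoRectPercolation α) (fun ω ↦ (isoRectLoopConfig δ α ω).map
          (RandomPlanarGeometry.toCM (rotation (Circle.exp (θ + θ')))) (rotation (Circle.exp (θ + θ'))).isometry) ≤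
      RandomPlanarGeometry.LoopConfig.cnLawEDist (isoRectPercolation α) (isoRectLoopConfig δ α)
        (isoRectPercolation α) (fun ω ↦ (isoRectLoopConfig δ α ω).map
          (RandomPlanarGeometry.toCM (rotation (Circle.exp θ))) (rotation (Circle.exp θ)).isometry) +
      RandomPlanarGeometry.LoopConfig.cnLawEDist (isoRectPercolation α) (isoRectLoopConfig δ α)
        (isoRectPercolation α) (fun ω ↦ (isoRectLoopConfig δ α ω).map
          (RandomPlanarGeometry.toCM (rotation (Circle.exp θ'))) (rotation (Circle.exp θ')).isometry) := by
  haveI := standardBorelSpace_bondConfig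
  set μ := isoRectPercolation α with hμ
  set X : BondConfig (Site 2) → RandomPlanarGeometry.LoopConfig ℂ := isoRectLoopConfig δ α with hX
  set R : ℂ ≃ₗᵢ[ℝ] ℂ := rotation (Circle.exp θ) with hRdef
  set R' : ℂ ≃ₗᵢ[ℝ] ℂ := rotation (Circle.exp θ') with hR'def
  set R'' : ℂ ≃ₗᵢ[ℝ] ℂ := rotation (Circle.exp (θ + θ')) with hR''def
  have hR : Isometry (RandomPlanarGeometry.toCM R) := R.isometry
  have hR' : Isometry (RandomPlanarGeometry.toCM R') := R'.isometry
  have hR'' : Isometry (RandomPlanarGeometry.toCM R'') := R''.isometry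
  have hR0 : RandomPlanarGeometry.toCM R 0 = 0 := map_zero R
  set RX : BondConfig (Site 2) → RandomPlanarGeometry.LoopConfig ℂ :=
    fun ω ↦ (X ω).map (RandomPlanarGeometry.toCM R) hR with hRX
  refine (RandomPlanarGeometry.LoopConfig.cnLawEDist_triangle μ μ μ X RX _
    (measurableSet_isClose_isoRectLoopConfig_map δ α δ α R'')).trans (add_le_add le_rfl (le_of_eq ?_))
  refine RandomPlanarGeometry.LoopConfig.cnLawEDist_congr fun ε ω ω' ↦ ?_
  have hcomp := toCM_rotation_comp θ θ'
  rw [hRX]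
  change RandomPlanarGeometry.LoopConfig.IsClose ε ((X ω).map (RandomPlanarGeometry.toCM R) hR)
      ((X ω').map (RandomPlanarGeometry.toCM R'') hR'') ↔
    RandomPlanarGeometry.LoopConfig.IsClose ε (X ω) ((X ω').map (RandomPlanarGeometry.toCM R') hR')
  rw [← RandomPlanarGeometry.LoopConfig.map_congr hcomp (hR.comp hR') hR'',
    ← RandomPlanarGeometry.LoopConfig.map_map hR' hR, RandomPlanarGeometry.LoopConfig.isClose_map_iff hR hR0]

/-- **Transfer of the rotation defect along similarity**: `ρ_α^δ(θ) ≤ 2 d_CN(φ_{δL(α)},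
φ_{δL(π/2)}) + ρ_{π/2}^δ(θ)` ("as a consequence of the definition of `R`, so is `φ_{L(α)}` for
any `α ∈ R`", DKKMO §4.2): two triangle inequalities for the coupling distance and the invariance
of `d_CN ≤ ε` under `R_θ`. [cite: arXiv201211672v2, §4.2] -/
theorem cnLawEDist_isoRect_rotation_le (α δ θ : ℝ) :
    RandomPlanarGeometry.LoopConfig.cnLawEDist (isoRectPercolation α) (isoRectLoopConfig δ α)
        (isoRectPercolation α) (fun ω ↦ (isoRectLoopConfig δ α ω).map
          (RandomPlanarGeometry.toCM (rotation (Circle.exp θ))) (rotation (Circle.exp θ)).isometry) ≤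
      2 * RandomPlanarGeometry.LoopConfig.cnLawEDist (isoRectPercolation α) (isoRectLoopConfig δ α)
        (isoRectPercolation (π / 2)) (isoRectLoopConfig δ (π / 2)) +
      RandomPlanarGeometry.LoopConfig.cnLawEDist (isoRectPercolation (π / 2)) (isoRectLoopConfig δ (π / 2))
        (isoRectPercolation (π / 2)) (fun ω ↦ (isoRectLoopConfig δ (π / 2) ω).map
          (RandomPlanarGeometry.toCM (rotation (Circle.exp θ))) (rotation (Circle.exp θ)).isometry) := by
  haveI := standardBorelSpace_bondConfig
  set μα := isoRectPercolation α with hμα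
  set μ := isoRectPercolation (π / 2) with hμ
  set Xα : BondConfig (Site 2) → RandomPlanarGeometry.LoopConfig ℂ := isoRectLoopConfig δ α with hXα
  set X : BondConfig (Site 2) → RandomPlanarGeometry.LoopConfig ℂ := isoRectLoopConfig δ (π / 2) with hX
  set R : ℂ ≃ₗᵢ[ℝ] ℂ := rotation (Circle.exp θ) with hRdef
  have hR : Isometry (RandomPlanarGeometry.toCM R) := R.isometry
  have hR0 : RandomPlanarGeometry.toCM R 0 = 0 := map_zero R
  set RXα : BondConfig (Site 2) → RandomPlanarGeometry.LoopConfig ℂ :=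
    fun ω ↦ (Xα ω).map (RandomPlanarGeometry.toCM R) hR with hRXα
  set RX : BondConfig (Site 2) → RandomPlanarGeometry.LoopConfig ℂ :=
    fun ω ↦ (X ω).map (RandomPlanarGeometry.toCM R) hR with hRX
  -- first triangle, through `(μ, X)`
  have h1 : RandomPlanarGeometry.LoopConfig.cnLawEDist μα Xα μα RXα ≤
      RandomPlanarGeometry.LoopConfig.cnLawEDist μα Xα μ X + RandomPlanarGeometry.LoopConfig.cnLawEDist μ X μα RXα :=
    RandomPlanarGeometry.LoopConfig.cnLawEDist_triangle μα μ μα Xα X RXα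
      (measurableSet_isClose_isoRectLoopConfig_map δ α δ α R)
  -- second triangle, through `(μ, R X)`
  have h2 : RandomPlanarGeometry.LoopConfig.cnLawEDist μ X μα RXα ≤
      RandomPlanarGeometry.LoopConfig.cnLawEDist μ X μ RX + RandomPlanarGeometry.LoopConfig.cnLawEDist μ RX μα RXα :=
    RandomPlanarGeometry.LoopConfig.cnLawEDist_triangle μ μ μα X RX RXα
      (measurableSet_isClose_isoRectLoopConfig_map δ (π / 2) δ α R)
  -- the rotation is an isometry fixing `0`
  have h3 : RandomPlanarGeometry.LoopConfig.cnLawEDist μ RX μα RXα = RandomPlanarGeometry.LoopConfig.cnLawEDist μα Xα μ X := by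
    rw [RandomPlanarGeometry.LoopConfig.cnLawEDist_comm]
    exact RandomPlanarGeometry.LoopConfig.cnLawEDist_congr fun ε ω ω' ↦
      RandomPlanarGeometry.LoopConfig.isClose_map_iff hR hR0
  calc RandomPlanarGeometry.LoopConfig.cnLawEDist μα Xα μα RXα
      ≤ RandomPlanarGeometry.LoopConfig.cnLawEDist μα Xα μ X +
          (RandomPlanarGeometry.LoopConfig.cnLawEDist μ X μ RX + RandomPlanarGeometry.LoopConfig.cnLawEDist μ RX μα RXα) :=
        h1.trans (add_le_add le_rfl h2)
    _ = 2 * RandomPlanarGeometry.LoopConfig.cnLawEDist μα Xα μ X + RandomPlanarGeometry.LoopConfig.cnLawEDist μ X μ RX := by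
        rw [h3]; ring

/-- **Every reflection defect is dominated by a rotation defect**:
`d_CN((φ_{L(α)}, X_α^δ), (φ_{L(α)}, S_φ ∘ X_α^δ)) ≤ ρ_α^δ(2φ − α)` ("`φ_{δL(β)}` is invariant
under `S_{β/2}` and is assumed asymptotically rotationally invariant, which implies that it is
asymptotically invariant under all reflections", DKKMO §4.2, proof of Lemma 4.4). Mechanism:
`S_φ = R_{2φ−α} ∘ S_{α/2}` (`toCM_rotation_comp_lineReflection`); `S_{α/2} ∘ X_α^δ` is, up to
reversing members, `X_α^δ ∘ reflSite` (`mem_isoRectLoopConfig_image_iff`) with `reflSite` an exact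
measure-preserving involution of `φ_{L(α)}` (`isoRectPercolation_map_reflSite`), transported by
`cnLawEDist_map_le`. [cite: arXiv201211672v2, §4.2] -/
theorem cnLawEDist_isoRect_lineReflection_le (α δ φ : ℝ) :
    RandomPlanarGeometry.LoopConfig.cnLawEDist (isoRectPercolation α) (isoRectLoopConfig δ α)
        (isoRectPercolation α) (fun ω ↦ (isoRectLoopConfig δ α ω).map
          (RandomPlanarGeometry.toCM (RandomPlanarGeometry.lineReflection φ))
          (RandomPlanarGeometry.lineReflection φ).isometry) ≤
      RandomPlanarGeometry.LoopConfig.cnLawEDist (isoRectPercolation α) (isoRectLoopConfig δ α)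
        (isoRectPercolation α) (fun ω ↦ (isoRectLoopConfig δ α ω).map
          (RandomPlanarGeometry.toCM (rotation (Circle.exp (2 * φ - α))))
          (rotation (Circle.exp (2 * φ - α))).isometry) := by
  set μ := isoRectPercolation α with hμ
  set X : BondConfig (Site 2) → RandomPlanarGeometry.LoopConfig ℂ := isoRectLoopConfig δ α with hX
  set R : ℂ ≃ₗᵢ[ℝ] ℂ := rotation (Circle.exp (2 * φ - α)) with hRdef
  set S : ℂ ≃ₗᵢ[ℝ] ℂ := RandomPlanarGeometry.lineReflection (α / 2) with hSdef
  set Sφ : ℂ ≃ₗᵢ[ℝ] ℂ := RandomPlanarGeometry.lineReflection φ with hSφdef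
  have hR : Isometry (RandomPlanarGeometry.toCM R) := R.isometry
  have hS : Isometry (RandomPlanarGeometry.toCM S) := S.isometry
  have hSφ : Isometry (RandomPlanarGeometry.toCM Sφ) := Sφ.isometry
  set RX : BondConfig (Site 2) → RandomPlanarGeometry.LoopConfig ℂ :=
    fun ω ↦ (X ω).map (RandomPlanarGeometry.toCM R) hR with hRX
  set ρ : BondConfig (Site 2) → BondConfig (Site 2) := fun ω ↦ reflPerm '' ω with hρ
  have hρm : Measurable ρ := measurable_image_equiv reflPerm
  have hρρ : ∀ ω, ρ (ρ ω) = ω := fun ω ↦ by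
    simp only [hρ, coe_reflPerm]; exact isLatticeReflection_reflSite.image_image ω
  have hμρ : μ.map ρ = μ := isoRectPercolation_map_reflSite α
  -- pointwise: `S_φ (X ω')` versus `R (X (reflSite ω'))`, up to reversing members
  have hpt : ∀ ε ω ω', RandomPlanarGeometry.LoopConfig.IsClose ε (X ω)
      ((X ω').map (RandomPlanarGeometry.toCM Sφ) hSφ) ↔
      RandomPlanarGeometry.LoopConfig.IsClose ε (X ω) (RX (ρ ω')) := by
    intro ε ω ω'
    rw [← RandomPlanarGeometry.LoopConfig.map_congr (toCM_rotation_comp_lineReflection α φ) (hR.comp hS) hSφ,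
      ← RandomPlanarGeometry.LoopConfig.map_map hS hR, RandomPlanarGeometry.LoopConfig.isClose_comm,
      ← RandomPlanarGeometry.LoopConfig.isClose_map_reverse_congr hR
        (mem_isoRectLoopConfig_image_iff isLatticeReflection_reflSite (S := S)
          (isoRectMedialPoint_map_reflSite δ α) loopType_map_reflSite_reverse ω'),
      RandomPlanarGeometry.LoopConfig.isClose_comm]
    simp only [hRX, hρ, hX, coe_reflPerm]
  rw [RandomPlanarGeometry.LoopConfig.cnLawEDist_congr hpt]
  -- transport along the measure-preserving involution `reflSite` on the second coordinate
  have gX := gen_isoRectLoopConfig δ α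
  have gRX := RandomPlanarGeometry.LoopConfig.gen_map gX (RandomPlanarGeometry.toCM R) hR
  have hmS := fun i (k : {γ : List MedialVertex // γ ≠ []}) ↦ measurableSet_setOf_isInterfaceLoop_and k.1 i
  have hm : ∀ ε, MeasurableSet {p : BondConfig (Site 2) × BondConfig (Site 2) |
      RandomPlanarGeometry.LoopConfig.IsClose ε (X p.1) ((RX ∘ ρ) p.2)} := fun ε ↦
    RandomPlanarGeometry.LoopConfig.measurableSet_isClose_of_gen hmS gX
      (fun i k ↦ hρm (hmS i k)) (RandomPlanarGeometry.LoopConfig.gen_comp gRX ρ) ε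
  have key := RandomPlanarGeometry.LoopConfig.cnLawEDist_map_le measurable_id hρm μ μ X (RX ∘ ρ) hm
  rw [Measure.map_id, hμρ] at key
  refine key.trans (le_of_eq (RandomPlanarGeometry.LoopConfig.cnLawEDist_congr fun ε ω ω' ↦ ?_))
  simp only [Function.comp_apply, id_eq, hρρ]

/-- **Asymptotic rotational invariance of every `φ_{L(α)}`, from Theorem 1.7** ("Theorem 1.2
implies that `φ_{L(π/2)}` is asymptotically rotationally invariant. As a consequence of the
definition of `R`, so is `φ_{L(α)}` for any `α ∈ R`", DKKMO §4.2 — and `R = (0, π)` by Theorem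
1.7), quantitatively and in the printed `d_CN` conventions: there are `c, C > 0` with
`d_CN((φ_{L(α)}, X_α^δ), (φ_{L(α)}, R_θ ∘ X_α^δ)) ≤ C δ^c` for all `α ∈ (0, π)`, all angles `θ`
and all `δ > 0`. Steps: Remark 1.8 (`cnLawEDist_rotate_le`) bounds `ρ_{π/2}^δ(θ)` by
`2 d_CN(φ_{δL(θ)}, φ_{δL(π/2)})` for `θ ∈ (0, π)`; transfer along similarity
(`cnLawEDist_isoRect_rotation_le`); all angles by `ρ(0) = 0`, `2π`-periodicity and
sub-additivity (`cnLawEDist_isoRect_rotation_subadditive`); constant `8C`. [cite: arXiv201211672v2, §4.2] -/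
theorem dkkmo_theorem_1_7.rotation_invariance (h17 : dkkmo_theorem_1_7) :
    ∃ c C : ℝ, 0 < c ∧ 0 < C ∧ ∀ α ∈ Set.Ioo (0 : ℝ) π, ∀ θ δ : ℝ, 0 < δ →
      RandomPlanarGeometry.LoopConfig.cnLawEDist (isoRectPercolation α) (isoRectLoopConfig δ α)
        (isoRectPercolation α) (fun ω ↦ (isoRectLoopConfig δ α ω).map
          (RandomPlanarGeometry.toCM (rotation (Circle.exp θ))) (rotation (Circle.exp θ)).isometry) ≤
        ENNReal.ofReal (C * δ ^ c) := by
  obtain ⟨c, C, hc, hC, H⟩ := h17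
  refine ⟨c, 8 * C, hc, by positivity, fun α hα θ₀ δ hδ ↦ ?_⟩
  set ε := ENNReal.ofReal (C * δ ^ c) with hεdef
  set f : ℝ → ℝ≥0∞ := fun θ ↦ RandomPlanarGeometry.LoopConfig.cnLawEDist (isoRectPercolation α)
    (isoRectLoopConfig δ α) (isoRectPercolation α) (fun ω ↦ (isoRectLoopConfig δ α ω).map
      (RandomPlanarGeometry.toCM (rotation (Circle.exp θ))) (rotation (Circle.exp θ)).isometry) with hfdef
  change f θ₀ ≤ ENNReal.ofReal (8 * C * δ ^ c)
  -- Step 1: `θ ∈ (0, π)`: `f θ ≤ 2 d(α, π/2) + ρ_{π/2}(θ) ≤ 2ε + 2 d(θ, π/2) ≤ 4ε`.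
  have step1 : ∀ θ ∈ Set.Ioo (0 : ℝ) π, f θ ≤ 4 * ε := by
    intro θ hθ
    have hA := cnLawEDist_isoRect_rotation_le α δ θ
    have hB := cnLawEDist_rotate_le θ δ
    have h1 : RandomPlanarGeometry.LoopConfig.cnLawEDist (isoRectPercolation α) (isoRectLoopConfig δ α)
        (isoRectPercolation (π / 2)) (isoRectLoopConfig δ (π / 2)) ≤ ε := (H α hα δ hδ).le
    have h2 : RandomPlanarGeometry.LoopConfig.cnLawEDist (isoRectPercolation θ) (isoRectLoopConfig δ θ)
        (isoRectPercolation (π / 2)) (isoRectLoopConfig δ (π / 2)) ≤ ε := (H θ hθ δ hδ).le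
    calc f θ ≤ 2 * ε + 2 * ε := hA.trans (add_le_add (by gcongr) (hB.trans (by gcongr)))
      _ = 4 * ε := by rw [← add_mul]; norm_num
  -- Step 2: all angles, by `f 0 = 0`, periodicity and sub-additivity: `f ≤ 8ε`.
  have step2 : f θ₀ ≤ 8 * ε := by
    have hper : ∀ θ (n : ℤ), f (θ + n * (2 * π)) = f θ := fun θ n ↦
      cnLawEDist_isoRect_rotation_periodic α δ θ n
    have hsub : ∀ θ₁ θ₂, f (θ₁ + θ₂) ≤ f θ₁ + f θ₂ := fun θ₁ θ₂ ↦
      cnLawEDist_isoRect_rotation_subadditive α δ θ₁ θ₂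
    have h0 : f 0 = 0 := cnLawEDist_isoRect_rotation_zero α δ
    have h4ε : 4 * ε ≤ 8 * ε := by gcongr; norm_num
    have hmem : toIcoMod Real.two_pi_pos 0 θ₀ ∈ Set.Ico 0 (0 + 2 * π) :=
      toIcoMod_mem_Ico Real.two_pi_pos 0 θ₀
    have hθeq : f θ₀ = f (toIcoMod Real.two_pi_pos 0 θ₀) := by
      conv_lhs => rw [← toIcoMod_add_toIcoDiv_zsmul Real.two_pi_pos 0 θ₀, zsmul_eq_mul]
      exact hper _ _
    rw [hθeq]
    rcases hmem.1.eq_or_lt with h | h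
    · rw [← h, h0]; exact bot_le
    · by_cases hπ : toIcoMod Real.two_pi_pos 0 θ₀ < π
      · exact (step1 _ ⟨h, hπ⟩).trans h4ε
      · have hhalf : toIcoMod Real.two_pi_pos 0 θ₀ / 2 ∈ Set.Ioo (0 : ℝ) π := by
          constructor
          · linarith
          · have := hmem.2; linarith
        calc f (toIcoMod Real.two_pi_pos 0 θ₀)
            = f (toIcoMod Real.two_pi_pos 0 θ₀ / 2 + toIcoMod Real.two_pi_pos 0 θ₀ / 2) := by
              rw [add_halves]
          _ ≤ f (toIcoMod Real.two_pi_pos 0 θ₀ / 2) + f (toIcoMod Real.two_pi_pos 0 θ₀ / 2) := hsub _ _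
          _ ≤ 4 * ε + 4 * ε := add_le_add (step1 _ hhalf) (step1 _ hhalf)
          _ = 8 * ε := by rw [← add_mul]; norm_num
  -- Step 3: constants.
  have h8 : (8 : ℝ≥0∞) * ε = ENNReal.ofReal (8 * C * δ ^ c) := by
    rw [hεdef, mul_assoc, ENNReal.ofReal_mul (by norm_num : (0 : ℝ) ≤ 8), ENNReal.ofReal_ofNat]
  exact step2.trans (le_of_eq h8)

/-- **Asymptotic invariance of every `φ_{L(α)}` under all reflections, from Theorem 1.7**
("which implies that it is asymptotically invariant under all reflections", DKKMO §4.2, proof of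
Lemma 4.4), quantitatively and in the printed conventions: there are `c, C > 0` with
`d_CN((φ_{L(α)}, X_α^δ), (φ_{L(α)}, S_φ ∘ X_α^δ)) ≤ C δ^c` for all `α ∈ (0, π)`, all lines
`e^{iφ}ℝ` and all `δ > 0` (`cnLawEDist_isoRect_lineReflection_le` and
`dkkmo_theorem_1_7.rotation_invariance`). [cite: arXiv201211672v2, §4.2] -/
theorem dkkmo_theorem_1_7.reflection_invariance (h17 : dkkmo_theorem_1_7) :
    ∃ c C : ℝ, 0 < c ∧ 0 < C ∧ ∀ α ∈ Set.Ioo (0 : ℝ) π, ∀ φ δ : ℝ, 0 < δ →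
      RandomPlanarGeometry.LoopConfig.cnLawEDist (isoRectPercolation α) (isoRectLoopConfig δ α)
        (isoRectPercolation α) (fun ω ↦ (isoRectLoopConfig δ α ω).map
          (RandomPlanarGeometry.toCM (RandomPlanarGeometry.lineReflection φ))
          (RandomPlanarGeometry.lineReflection φ).isometry) ≤
        ENNReal.ofReal (C * δ ^ c) := by
  obtain ⟨c, C, hc, hC, H⟩ := h17.rotation_invariance
  exact ⟨c, C, hc, hC, fun α hα φ δ hδ ↦ (cnLawEDist_isoRect_lineReflection_le α δ φ).trans (H α hα _ δ hδ)⟩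

end Literature.Probability.Percolation

end
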